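import Literature.Barriers.CriticalPhenomena.LaceExpansionXSpaceTwoLongLinesShapes
import HarnessLib

/-!
# Junctions of Hara's two-long-lines estimate (§3.5) at `p_c`: the Cauchy–Schwarz bound for a
# chain with two erased kernels, the erased kernels and their one-line majorants — PROVED

Barrier catalogue `Literature/Barriers/CriticalPhenomena/` (D-0021), infrastructure for the
conditional reduction of `Hara2008_twoLongLinesDiagramBoundPc` (`LaceExpansionXSpaceLemma15Diagrams.lean`,
Hara 2008, §3.5), continuing `LaceExpansionXSpaceTwoLongLinesShapes.lean`.

A term of the Hara–Slade diagram with its two long lines erased is a chain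
`v L₁⋯L_a X U₁⋯U_k Y R₁⋯R_c e` in which `X` and `Y` are the two kernels that lost a line ("The
effect of extracting these `G`'s is nothing but erasing these two lines in the diagram"). What is
left of `X` is ONE two-point function entering one coordinate of the next pair (times, possibly, a
rung), and symmetrically for `Y`. PROVED here:

* `chain_cs_sq_le` — **the master estimate**: if `X(p,P) ≤ c_F f(P_{e₁} - π p) ρ₁(P)` and
  `Y(Q,q) ≤ ρ₂(Q) c_G g(Q_{e₂} - π' q)`, then
  `(Σ chain)² ≤ [‖vL‖₁² c_F² ‖f‖₂² pkHead_{e₁}(ρ₁·ΠU·ρ₂)] · [‖Re‖₁² c_G² ‖g‖₂² pkTail_{e₂}(ρ₁·ΠU·ρ₂)]`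
  (weighted Cauchy–Schwarz `sq_tsum_mul_le` for the entry and the exit, `tsum_mul_mul_sq_le` of
  `LaceExpansionXSpaceMiddleFactor.lean` for the middle), and `chain_cs_le` (square roots taken);
* the ERASED KERNELS at `p_c`: the constant line `oneF`, `B₁` with a line erased
  (`kProp oneF τ̃`, `kProp τ oneF`), the start/end triangle with a line erased (`kRungR`/`kRungL`
  of those), `B₂⁽¹⁾` with a crossed line erased (`kPropX` with a `oneF`, its two rungs moved to the
  neighbours by `pkMul_kRungR`), `B₂⁽²⁾` with its line `u → t` erased (`kB2twoEr`, a star tied to the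
  `δ`), with `kB2two = kB2twoEr · τ`;
* their ONE-LINE MAJORANTS in the form consumed by `chain_cs_sq_le` (`le_entry_…`, `le_exit_…`),
  including the merged block `B₁ · kB2twoEr · B₁ ≤ Δ̃Δ̄ (τ̃⋆τ)` (`pkMul_kB1_kB2twoEr_kB1_le`) — the
  star block cannot be cut at its own pair, so it is taken together with the two `B₁` around it;
* the `ℓ²` sums `Σ τ², Σ τ̃², Σ (τ̃⋆τ)² ≤ 𝕂³` and the suprema `τ ≤ 1`, `τ̃ ≤ 2d`, `τ⋆τ ≤ Δ̄`,
  `τ̃⋆τ ≤ Δ̃`.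

## References

* T. Hara, Ann. Probab. 36 (2008) 530–593 (arXiv:math-ph/0504021): §3.5 (Cases 1–2; Fig. 4–5).
* M. Heydenreich, R. van der Hofstad, *Progress in High-Dimensional Percolation and Random
  Graphs*, Springer 2017: (7.4.2)–(7.4.4), (7.4.10).
-/

noncomputable section

open scoped ENNReal

namespace Literature.Barriers.CriticalPhenomena

open _root_.MeasureTheory Literature.Probability.LatticeModels Literature.Probability.Percolation

/-! ### The master estimate: Cauchy–Schwarz for a chain with two erased kernels -/

section Master

variable {α : Type*}

/-- **Weighted Cauchy–Schwarz**: `(Σ_i L_i a_i)² ≤ (Σ_i L_i) (Σ_i L_i a_i²)`. (Deliberate local copy of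
`Literature.Analysis.FunctionSpaces.Lattice.sq_tsum_mul_le` (LatticeConvolution.lean), which is the
survivor for dedup purposes; not imported here to keep the percolation cone free of the function-space
files.) [folklore] -/
theorem sq_tsum_mul_le {ι : Type*} (L a : ι → ℝ≥0∞) :
    (∑' i, L i * a i) ^ 2 ≤ (∑' i, L i) * ∑' i, L i * a i ^ 2 := by
  have hsq : ∀ u : ℝ≥0∞, (u ^ (2⁻¹ : ℝ)) ^ 2 = u := fun u => ENNReal.rpow_inv_natCast_pow two_ne_zero u
  have hsplit : ∀ u : ℝ≥0∞, u = u ^ (2⁻¹ : ℝ) * u ^ (2⁻¹ : ℝ) := fun u => by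
    rw [← ENNReal.rpow_add_of_nonneg _ _ (by norm_num) (by norm_num),
      show (2⁻¹ : ℝ) + 2⁻¹ = 1 by norm_num, ENNReal.rpow_one]
  calc (∑' i, L i * a i) ^ 2 = (∑' i, L i ^ (2⁻¹ : ℝ) * (L i ^ (2⁻¹ : ℝ) * a i)) ^ 2 := by
        congr 1
        refine tsum_congr fun i => ?_
        rw [← mul_assoc, ← hsplit]
    _ ≤ (∑' i, (L i ^ (2⁻¹ : ℝ)) ^ 2) * ∑' i, (L i ^ (2⁻¹ : ℝ) * a i) ^ 2 := ennreal_sq_tsum_mul_le _ _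
    _ = (∑' i, L i) * ∑' i, L i * a i ^ 2 := by
        congr 1
        · exact tsum_congr fun i => hsq _
        · exact tsum_congr fun i => by rw [mul_pow, hsq]

/-- **The degenerate master estimate** (middle bounded pointwise): for the chain `v L M R e` with
`M ≤ s` pointwise, `Σ chain ≤ ‖vL‖₁ · s · ‖Re‖₁`, with numerical inputs.
[cite: Hara2008, §3.5 (Case 2: "decomposing it into open triangles and a square")] -/
theorem chain_sup_le (v e : α × α → ℝ≥0∞) (Lpre Rpost : List (α × α → α × α → ℝ≥0∞))
    (M : α × α → α × α → ℝ≥0∞) {s M₁ M₂ : ℝ≥0∞} (hM : ∀ p q, M p q ≤ s)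
    (h₁ : ∑' p, pkChainL v Lpre p ≤ M₁) (h₂ : ∑' q, pkChainR Rpost e q ≤ M₂) :
    ∑' t, pkChainL v (Lpre ++ M :: Rpost) t * e t ≤ M₁ * s * M₂ :=
  (tsum_pkChainL_middle_le v Lpre Rpost M e hM).trans (mul_le_mul' (mul_le_mul' h₁ le_rfl) h₂)

/-- Merging two consecutive kernels of a chain after a prefix. [folklore] -/
theorem pkChainL_append_cons_cons (v : α × α → ℝ≥0∞) (L : List (α × α → α × α → ℝ≥0∞))
    (A B : α × α → α × α → ℝ≥0∞) (R : List (α × α → α × α → ℝ≥0∞)) :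
    pkChainL v (L ++ A :: B :: R) = pkChainL v (L ++ pkMul A B :: R) := by
  rw [pkChainL_append, pkChainL_append, pkChainL_cons_cons]

/-- Moving the input rung of a kernel onto the previous kernel of a chain:
`v L K (ρ·Y) R = v L (K·ρ) Y R`. [folklore] -/
theorem pkChainL_append_cons_pkScaleL (v : α × α → ℝ≥0∞) (L : List (α × α → α × α → ℝ≥0∞))
    (K : α × α → α × α → ℝ≥0∞) (ρ : α × α → ℝ≥0∞) (Y : α × α → α × α → ℝ≥0∞)
    (R : List (α × α → α × α → ℝ≥0∞)) :
    pkChainL v (L ++ K :: pkScaleL ρ Y :: R) = pkChainL v (L ++ pkScaleR K ρ :: Y :: R) := by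
  rw [pkChainL_append_cons_cons, pkChainL_append_cons_cons, pkMul_pkScaleR]

/-- A scalar on a kernel comes out of a row-vector product. [folklore] -/
theorem pkVmul_const_mul (w : α × α → ℝ≥0∞) (c : ℝ≥0∞) (K : α × α → α × α → ℝ≥0∞) :
    pkVmul w (fun p q => c * K p q) = fun q => c * pkVmul w K q := by
  funext q
  simp only [pkVmul, ← ENNReal.tsum_mul_left]
  exact tsum_congr fun p => by ring

/-- A scalar on the row vector comes out of the chain. [folklore] -/
theorem pkChainL_smul_start : ∀ (R : List (α × α → α × α → ℝ≥0∞)) (w : α × α → ℝ≥0∞) (c : ℝ≥0∞),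
    pkChainL (fun q => c * w q) R = fun q => c * pkChainL w R q
  | [], _, _ => rfl
  | Z :: R, w, c => by
    rw [pkChainL_cons, pkChainL_cons]
    have h : pkVmul (fun q => c * w q) Z = fun q => c * pkVmul w Z q := by
      funext q; simp only [pkVmul, ← ENNReal.tsum_mul_left]; exact tsum_congr fun p => by ring
    rw [h, pkChainL_smul_start R]

/-- A scalar multiple of one kernel comes out of the chain. [folklore] -/
theorem pkChainL_append_cons_const_mul (v : α × α → ℝ≥0∞) (L : List (α × α → α × α → ℝ≥0∞))
    (c : ℝ≥0∞) (K : α × α → α × α → ℝ≥0∞) (R : List (α × α → α × α → ℝ≥0∞)) (q : α × α) :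
    pkChainL v (L ++ (fun p q => c * K p q) :: R) q = c * pkChainL v (L ++ K :: R) q := by
  rw [pkChainL_append, pkChainL_append, pkChainL_cons, pkChainL_cons, pkVmul_const_mul, pkChainL_smul_start]

variable [AddCommGroup α]

/-- **The entry closes** (left certificate): for the entry vector `F̃(P) = Σ_p L(p) c_F f(P_e - π p)`
(the left chain `L` followed by one line into coordinate `e` of `P`),
`Σ_P F̃(P)² row(U)(P) ≤ ‖L‖₁² (c_F² ‖f‖₂²) pkHead_e(U)`. [cite: Hara2008, §3.5 (Case 2)] -/
theorem leftCert_le (e : Bool) (L : α × α → ℝ≥0∞) (cF : ℝ≥0∞) (f : α → ℝ≥0∞) (πF : α × α → α)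
    (U : α × α → α × α → ℝ≥0∞) :
    ∑' P, (∑' p, L p * (cF * f (crd e P - πF p))) ^ 2 * pkRow U P ≤
      (∑' p, L p) ^ 2 * (cF ^ 2 * ∑' a, f a ^ 2) * pkHeadB e U := by
  have hshift : ∀ c : α, ∑' a, f (a - c) ^ 2 = ∑' a, f a ^ 2 := fun c =>
    (Equiv.subRight c).tsum_eq (fun a => f a ^ 2)
  have hp : ∀ p, ∑' P, (cF * f (crd e P - πF p)) ^ 2 * pkRow U P ≤ cF ^ 2 * (∑' a, f a ^ 2) * pkHeadB e U := by
    intro p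
    calc ∑' P, (cF * f (crd e P - πF p)) ^ 2 * pkRow U P ≤ cF ^ 2 * (∑' a, f (a - πF p) ^ 2) * pkHeadB e U :=
          tsum_sq_mul_pkRow_le_pkHeadB e U (f := fun a => f (a - πF p)) fun P => le_of_eq (mul_comm _ _)
      _ = cF ^ 2 * (∑' a, f a ^ 2) * pkHeadB e U := by rw [hshift]
  calc ∑' P, (∑' p, L p * (cF * f (crd e P - πF p))) ^ 2 * pkRow U P
      ≤ ∑' P, ((∑' p, L p) * ∑' p, L p * (cF * f (crd e P - πF p)) ^ 2) * pkRow U P :=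
        ENNReal.tsum_le_tsum fun P => mul_le_mul' (sq_tsum_mul_le _ _) le_rfl
    _ = (∑' p, L p) * ∑' P, (∑' p, L p * (cF * f (crd e P - πF p)) ^ 2) * pkRow U P := by
        rw [← ENNReal.tsum_mul_left]; exact tsum_congr fun P => mul_assoc _ _ _
    _ = (∑' p, L p) * ∑' P, ∑' p, L p * ((cF * f (crd e P - πF p)) ^ 2 * pkRow U P) := by
        congr 1; refine tsum_congr fun P => ?_
        rw [← ENNReal.tsum_mul_right]; exact tsum_congr fun p => mul_assoc _ _ _
    _ = (∑' p, L p) * ∑' p, L p * ∑' P, (cF * f (crd e P - πF p)) ^ 2 * pkRow U P := by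
        congr 1; rw [ENNReal.tsum_comm]; exact tsum_congr fun p => ENNReal.tsum_mul_left
    _ ≤ (∑' p, L p) * ∑' p, L p * (cF ^ 2 * (∑' a, f a ^ 2) * pkHeadB e U) :=
        mul_le_mul' le_rfl (ENNReal.tsum_le_tsum fun p => mul_le_mul' le_rfl (hp p))
    _ = (∑' p, L p) ^ 2 * (cF ^ 2 * ∑' a, f a ^ 2) * pkHeadB e U := by
        rw [ENNReal.tsum_mul_right]; ring

/-- **The exit closes** (right certificate): for the exit vector `G̃(Q) = Σ_q c_G g(Q_e - π q) R(q)`,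
`Σ_Q col(U)(Q) G̃(Q)² ≤ ‖R‖₁² (c_G² ‖g‖₂²) pkTail_e(U)`. [cite: Hara2008, §3.5 (Case 2)] -/
theorem rightCert_le (e : Bool) (R : α × α → ℝ≥0∞) (cG : ℝ≥0∞) (g : α → ℝ≥0∞) (πG : α × α → α)
    (U : α × α → α × α → ℝ≥0∞) :
    ∑' Q, pkCol U Q * (∑' q, (cG * g (crd e Q - πG q)) * R q) ^ 2 ≤
      (∑' q, R q) ^ 2 * (cG ^ 2 * ∑' a, g a ^ 2) * pkTailB e U := by
  have hshift : ∀ c : α, ∑' a, g (a - c) ^ 2 = ∑' a, g a ^ 2 := fun c =>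
    (Equiv.subRight c).tsum_eq (fun a => g a ^ 2)
  have hq : ∀ q, ∑' Q, pkCol U Q * (cG * g (crd e Q - πG q)) ^ 2 ≤ cG ^ 2 * (∑' a, g a ^ 2) * pkTailB e U := by
    intro q
    calc ∑' Q, pkCol U Q * (cG * g (crd e Q - πG q)) ^ 2 ≤ cG ^ 2 * (∑' a, g (a - πG q) ^ 2) * pkTailB e U :=
          tsum_pkCol_mul_sq_le_pkTailB e U (g := fun a => g (a - πG q)) fun Q => le_of_eq (mul_comm _ _)
      _ = cG ^ 2 * (∑' a, g a ^ 2) * pkTailB e U := by rw [hshift]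
  calc ∑' Q, pkCol U Q * (∑' q, (cG * g (crd e Q - πG q)) * R q) ^ 2
      = ∑' Q, pkCol U Q * (∑' q, R q * (cG * g (crd e Q - πG q))) ^ 2 := by
        refine tsum_congr fun Q => ?_
        congr 2; exact tsum_congr fun q => mul_comm _ _
    _ ≤ ∑' Q, pkCol U Q * ((∑' q, R q) * ∑' q, R q * (cG * g (crd e Q - πG q)) ^ 2) :=
        ENNReal.tsum_le_tsum fun Q => mul_le_mul' le_rfl (sq_tsum_mul_le _ _)
    _ = (∑' q, R q) * ∑' Q, pkCol U Q * ∑' q, R q * (cG * g (crd e Q - πG q)) ^ 2 := by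
        rw [← ENNReal.tsum_mul_left]; exact tsum_congr fun Q => mul_left_comm _ _ _
    _ = (∑' q, R q) * ∑' Q, ∑' q, R q * (pkCol U Q * (cG * g (crd e Q - πG q)) ^ 2) := by
        congr 1; refine tsum_congr fun Q => ?_
        rw [← ENNReal.tsum_mul_left]; exact tsum_congr fun q => mul_left_comm _ _ _
    _ = (∑' q, R q) * ∑' q, R q * ∑' Q, pkCol U Q * (cG * g (crd e Q - πG q)) ^ 2 := by
        congr 1; rw [ENNReal.tsum_comm]; exact tsum_congr fun q => ENNReal.tsum_mul_left
    _ ≤ (∑' q, R q) * ∑' q, R q * (cG ^ 2 * (∑' a, g a ^ 2) * pkTailB e U) :=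
        mul_le_mul' le_rfl (ENNReal.tsum_le_tsum fun q => mul_le_mul' le_rfl (hq q))
    _ = (∑' q, R q) ^ 2 * (cG ^ 2 * ∑' a, g a ^ 2) * pkTailB e U := by
        rw [ENNReal.tsum_mul_right]; ring

variable [DecidableEq α]

omit [AddCommGroup α] in
/-- The chain `v L X U Y R e` as `Σ_p (vL)(p) (X (ΠU) (Y (R e)))(p)`. [folklore] -/
theorem tsum_pkChainL_two_marks_eq (v e : α × α → ℝ≥0∞) (Lpre Umid Rpost : List (α × α → α × α → ℝ≥0∞))
    (X Y : α × α → α × α → ℝ≥0∞) :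
    ∑' s, pkChainL v (Lpre ++ X :: (Umid ++ Y :: Rpost)) s * e s =
      ∑' p, pkChainL v Lpre p * pkKvec X (pkKvec (pkProdI Umid) (pkKvec Y (pkChainR Rpost e))) p := by
  rw [pkChainL_append, tsum_pkChainL_mul, pkChainR_cons, pkChainR_append, pkChainR_eq_pkKvec_pkProdI,
    pkChainR_cons]

/-- **THE MASTER ESTIMATE (squared)** — Cauchy–Schwarz for a chain with two erased kernels. Let the
chain be `v L₁⋯L_a X U₁⋯U_k Y R₁⋯R_c e`, where the entry kernel is dominated by one line into
coordinate `e₁` of the next pair and a rung, `X(p,P) ≤ c_F f(P_{e₁} - π p) ρ₁(P)`, and the exit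
kernel by a rung and one line out of coordinate `e₂`, `Y(Q,q) ≤ ρ₂(Q) c_G g(Q_{e₂} - π' q)`. Then
`(Σ_s chain(s) e(s))² ≤ [‖vL‖₁² c_F² ‖f‖₂² pkHead_{e₁}(ρ₁·ΠU·ρ₂)] · [‖Re‖₁² c_G² ‖g‖₂² pkTail_{e₂}(ρ₁·ΠU·ρ₂)]`
("the component in the middle which is hard to deal with" is bounded by Schwarz; here the two
Schwarz factors are one copy of the middle each, closed by the entry, resp. the exit line).
[cite: Hara2008, §3.5 (Case 2, (d-1): "bounded by the Schwarz inequality")] -/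
theorem chain_cs_sq_le (v e : α × α → ℝ≥0∞) (Lpre Umid Rpost : List (α × α → α × α → ℝ≥0∞))
    (X Y : α × α → α × α → ℝ≥0∞) (e1 e2 : Bool) {cF cG : ℝ≥0∞} {f g : α → ℝ≥0∞}
    {πF πG : α × α → α} {ρ₁ ρ₂ : α × α → ℝ≥0∞}
    (hX : ∀ p P, X p P ≤ cF * f (crd e1 P - πF p) * ρ₁ P)
    (hY : ∀ Q q, Y Q q ≤ ρ₂ Q * (cG * g (crd e2 Q - πG q))) :
    (∑' s, pkChainL v (Lpre ++ X :: (Umid ++ Y :: Rpost)) s * e s) ^ 2 ≤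
      ((∑' p, pkChainL v Lpre p) ^ 2 * (cF ^ 2 * ∑' a, f a ^ 2) * pkHeadB e1 (midU ρ₁ Umid ρ₂)) *
      ((∑' q, pkChainR Rpost e q) ^ 2 * (cG ^ 2 * ∑' a, g a ^ 2) * pkTailB e2 (midU ρ₁ Umid ρ₂)) := by
  -- the chain is at most `Σ_{P,Q} F̃(P) 𝒰(P,Q) G̃(Q)`
  have hS : (∑' s, pkChainL v (Lpre ++ X :: (Umid ++ Y :: Rpost)) s * e s) ≤
      ∑' P, ∑' Q, (∑' p, pkChainL v Lpre p * (cF * f (crd e1 P - πF p))) * midU ρ₁ Umid ρ₂ P Q *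
        ∑' q, (cG * g (crd e2 Q - πG q)) * pkChainR Rpost e q := by
    rw [tsum_pkChainL_two_marks_eq]
    have hYR : ∀ Q, pkKvec Y (pkChainR Rpost e) Q ≤ ρ₂ Q * ∑' q, (cG * g (crd e2 Q - πG q)) * pkChainR Rpost e q := by
      intro Q
      calc pkKvec Y (pkChainR Rpost e) Q = ∑' q, Y Q q * pkChainR Rpost e q := rfl
        _ ≤ ∑' q, ρ₂ Q * (cG * g (crd e2 Q - πG q)) * pkChainR Rpost e q :=
            ENNReal.tsum_le_tsum fun q => mul_le_mul' (hY Q q) le_rfl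
        _ = ρ₂ Q * ∑' q, (cG * g (crd e2 Q - πG q)) * pkChainR Rpost e q := by
            rw [← ENNReal.tsum_mul_left]; exact tsum_congr fun q => mul_assoc _ _ _
    calc ∑' p, pkChainL v Lpre p * pkKvec X (pkKvec (pkProdI Umid) (pkKvec Y (pkChainR Rpost e))) p
        ≤ ∑' p, pkChainL v Lpre p * ∑' P, (cF * f (crd e1 P - πF p) * ρ₁ P) *
            ∑' Q, pkProdI Umid P Q * (ρ₂ Q * ∑' q, (cG * g (crd e2 Q - πG q)) * pkChainR Rpost e q) := by
          refine ENNReal.tsum_le_tsum fun p => mul_le_mul' le_rfl ?_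
          refine ENNReal.tsum_le_tsum fun P => mul_le_mul' (hX p P) ?_
          exact ENNReal.tsum_le_tsum fun Q => mul_le_mul' le_rfl (hYR Q)
      _ = ∑' p, ∑' P, pkChainL v Lpre p * ((cF * f (crd e1 P - πF p) * ρ₁ P) *
            ∑' Q, pkProdI Umid P Q * (ρ₂ Q * ∑' q, (cG * g (crd e2 Q - πG q)) * pkChainR Rpost e q)) :=
          tsum_congr fun p => ENNReal.tsum_mul_left.symm
      _ = ∑' P, ∑' p, pkChainL v Lpre p * ((cF * f (crd e1 P - πF p) * ρ₁ P) *
            ∑' Q, pkProdI Umid P Q * (ρ₂ Q * ∑' q, (cG * g (crd e2 Q - πG q)) * pkChainR Rpost e q)) :=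
          ENNReal.tsum_comm
      _ = ∑' P, (∑' p, pkChainL v Lpre p * (cF * f (crd e1 P - πF p))) * (ρ₁ P *
            ∑' Q, pkProdI Umid P Q * (ρ₂ Q * ∑' q, (cG * g (crd e2 Q - πG q)) * pkChainR Rpost e q)) := by
          refine tsum_congr fun P => ?_
          rw [← ENNReal.tsum_mul_right]
          exact tsum_congr fun p => by ring
      _ = _ := by
          refine tsum_congr fun P => ?_
          rw [← ENNReal.tsum_mul_left, ← ENNReal.tsum_mul_left]
          refine tsum_congr fun Q => ?_
          rw [midU_apply]
          ring
  calc (∑' s, pkChainL v (Lpre ++ X :: (Umid ++ Y :: Rpost)) s * e s) ^ 2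
      ≤ (∑' P, ∑' Q, (∑' p, pkChainL v Lpre p * (cF * f (crd e1 P - πF p))) * midU ρ₁ Umid ρ₂ P Q *
          ∑' q, (cG * g (crd e2 Q - πG q)) * pkChainR Rpost e q) ^ 2 := pow_le_pow_left' hS 2
    _ ≤ (∑' P, (∑' p, pkChainL v Lpre p * (cF * f (crd e1 P - πF p))) ^ 2 * pkRow (midU ρ₁ Umid ρ₂) P) *
          ∑' Q, pkCol (midU ρ₁ Umid ρ₂) Q * (∑' q, (cG * g (crd e2 Q - πG q)) * pkChainR Rpost e q) ^ 2 :=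
        tsum_mul_mul_sq_le (fun P => ∑' p, pkChainL v Lpre p * (cF * f (crd e1 P - πF p)))
          (fun Q => ∑' q, (cG * g (crd e2 Q - πG q)) * pkChainR Rpost e q) (midU ρ₁ Umid ρ₂)
    _ ≤ _ := mul_le_mul' (leftCert_le e1 (pkChainL v Lpre) cF f πF (midU ρ₁ Umid ρ₂))
        (rightCert_le e2 (pkChainR Rpost e) cG g πG (midU ρ₁ Umid ρ₂))

/-- **THE MASTER ESTIMATE** with the five numerical inputs: the mass of the left chain, the entry
constant `c_F² ‖f‖₂²`, the head and tail of the middle factor, the exit constant and the mass of the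
right chain. If their product is at most `B²`, the chain is at most `B`.
[cite: Hara2008, §3.5 (Case 2, (d-1)–(d-3))] -/
theorem chain_cs_le (v e : α × α → ℝ≥0∞) (Lpre Umid Rpost : List (α × α → α × α → ℝ≥0∞))
    (X Y : α × α → α × α → ℝ≥0∞) (e1 e2 : Bool) {cF cG : ℝ≥0∞} {f g : α → ℝ≥0∞}
    {πF πG : α × α → α} {ρ₁ ρ₂ : α × α → ℝ≥0∞}
    (hX : ∀ p P, X p P ≤ cF * f (crd e1 P - πF p) * ρ₁ P)
    (hY : ∀ Q q, Y Q q ≤ ρ₂ Q * (cG * g (crd e2 Q - πG q)))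
    {M₁ A H T C M₂ B : ℝ≥0∞}
    (h₁ : ∑' p, pkChainL v Lpre p ≤ M₁) (hA : cF ^ 2 * ∑' a, f a ^ 2 ≤ A)
    (hH : pkHeadB e1 (midU ρ₁ Umid ρ₂) ≤ H) (hT : pkTailB e2 (midU ρ₁ Umid ρ₂) ≤ T)
    (hC : cG ^ 2 * ∑' a, g a ^ 2 ≤ C) (h₂ : ∑' q, pkChainR Rpost e q ≤ M₂)
    (hB : M₁ ^ 2 * A * H * (M₂ ^ 2 * C * T) ≤ B ^ 2) :
    ∑' s, pkChainL v (Lpre ++ X :: (Umid ++ Y :: Rpost)) s * e s ≤ B := by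
  refine (ENNReal.pow_le_pow_left_iff two_ne_zero).1 ((chain_cs_sq_le v e Lpre Umid Rpost X Y e1 e2 hX hY).trans (le_trans ?_ hB))
  exact mul_le_mul' (mul_le_mul' (mul_le_mul' (pow_le_pow_left' h₁ 2) hA) hH)
    (mul_le_mul' (mul_le_mul' (pow_le_pow_left' h₂ 2) hC) hT)

end Master

/-! ### The erased kernels at `p_c` -/

section Erased

variable {d : ℕ}

/-- The erased line: the constant `1` (the long line is replaced by its bound `b`, pulled out of
the chain as a scalar). [cite: Hara2008, §3.5 ("nothing but erasing these two lines")] -/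
def oneF (d : ℕ) : Site d → ℝ≥0∞ := fun _ => 1

/-- Unfolding of `oneF`. [folklore] -/
@[simp] theorem oneF_apply (v : Site d) : oneF d v = 1 := rfl

/-- **`B₂⁽²⁾` with its line `u → t` erased**: `kB2twoEr((u,v),(s,t)) = δ_{v,s} Σ_a τ(a-u) τ(v-a) τ(t-a)`
(the star at `a` tied to the `δ`-vertex). [cite: HeydenreichVanDerHofstad2017, (7.4.4)] -/
def kB2twoEr (d : ℕ) (p q : Site d × Site d) : ℝ≥0∞ :=
  if p.2 = q.1 then ∑' a : Site d, tauPcE d (a - p.1) * tauPcE d (p.2 - a) * tauPcE d (q.2 - a) else 0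

/-- `B₂⁽²⁾ = kB2twoEr · τ(t - u)` (the erased line put back). [cite: HeydenreichVanDerHofstad2017, (7.4.4)] -/
theorem kB2two_eq_kB2twoEr_mul (p q : Site d × Site d) :
    kB2two d p q = kB2twoEr d p q * tauPcE d (q.2 - p.1) := by
  simp only [kB2two, percB2two, kB2twoEr]
  split_ifs with h
  · rw [← ENNReal.tsum_mul_right]
    refine tsum_congr fun a => ?_
    rw [← h, tauPcE_sub_comm a p.2, tauPcE_sub_comm p.1 a]
    ring
  · rw [zero_mul]

/-- `τ̃⋆τ`: `bbT(y) := Σ_t τ̃(t) τ(y - t)`. [cite: Hara2008, §3.4] -/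
def bbT (d : ℕ) (y : Site d) : ℝ≥0∞ := ∑' t : Site d, tauTildePcE d t * tauPcE d (y - t)

/-- `Σ_t τ̃(t - a) τ(b - t) = bbT(b - a)`. [folklore] -/
theorem tsum_tauTilde_tau_eq_bbT (a b : Site d) :
    ∑' t : Site d, tauTildePcE d (t - a) * tauPcE d (b - t) = bbT d (b - a) := by
  rw [bbT, tsum_shift _ a]
  refine tsum_congr fun t => ?_
  rw [add_sub_cancel_right, show b - (t + a) = b - a - t by abel]

/-- `Σ_t τ(t - a) τ̃(b - t) = bbT(b - a)` (the other orientation, by evenness). [folklore] -/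
theorem tsum_tau_tauTilde_eq_bbT (a b : Site d) :
    ∑' t : Site d, tauPcE d (t - a) * tauTildePcE d (b - t) = bbT d (b - a) := by
  rw [bbT, tsum_reflect_shift _ b]
  refine tsum_congr fun t => ?_
  rw [show b - (b - t) = t by abel, show b - t - a = b - a - t by abel, mul_comm]

/-- `bbT` is even. [folklore] -/
theorem bbT_neg (y : Site d) : bbT d (-y) = bbT d y := by
  rw [bbT, bbT, ← (Equiv.neg (Site d)).tsum_eq (fun t => tauTildePcE d t * tauPcE d (-y - t))]
  refine tsum_congr fun t => ?_
  simp only [Equiv.neg_apply, tauTildePcE_neg]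
  rw [show -y - -t = -(y - t) by abel, tauPcE_neg]

/-- `bbT ≤ 2d (τ⋆τ)` pointwise. [cite: Hara2008, §3.4 (the line 2dp(D ⋆ G))] -/
theorem bbT_le_percBubble (y : Site d) : bbT d y ≤ 2 * d * percBubble d y := by
  rw [bbT, percBubble, ← ENNReal.tsum_mul_left]
  refine ENNReal.tsum_le_tsum fun t => ?_
  rw [← mul_assoc]
  exact mul_le_mul' (tauTildePcE_le t) le_rfl

/-- `bbT ≤ Δ̃_{p_c}` pointwise (the term `y = 0` of `Δ̃(x) = Σ_{y,z} τ(y)τ(z-y)τ̃(x-z)`).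
[cite: HeydenreichVanDerHofstad2017, (7.2.2)] -/
theorem bbT_le_percTriTildeBar (x : Site d) : bbT d x ≤ percTriTildeBar d := by
  have h0 := tsum_tau_tauTilde_eq_bbT (d := d) 0 x
  rw [sub_zero] at h0
  have h1 : bbT d x ≤ percTriTilde d x := by
    rw [percTriTilde, ENNReal.tsum_prod']
    calc bbT d x = ∑' z : Site d, tauPcE d (z - 0) * tauTildePcE d (x - z) := h0.symm
      _ = ∑' z : Site d, tauPcE d 0 * tauPcE d (z - 0) * tauTildePcE d (x - z) :=
          tsum_congr fun z => by rw [tauPcE_zero, one_mul]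
      _ ≤ ∑' y : Site d, ∑' z : Site d, tauPcE d y * tauPcE d (z - y) * tauTildePcE d (x - z) :=
          ENNReal.le_tsum (f := fun y => ∑' z : Site d, tauPcE d y * tauPcE d (z - y) * tauTildePcE d (x - z)) 0
  exact h1.trans (le_iSup (percTriTilde d) x)

/-- `Σ_v (τ⋆τ)(v)² = S(0)`. [cite: Hara2008, §1.1] -/
theorem tsum_percBubble_sq : ∑' v : Site d, percBubble d v ^ 2 = percSq d 0 := by
  rw [percSq_eq_tsum_percBubble_tau_tau, ENNReal.tsum_prod']
  refine tsum_congr fun v => ?_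
  calc percBubble d v ^ 2 = percBubble d v * percBubble d (0 - v) := by rw [zero_sub, percBubble_neg, sq]
    _ = percBubble d v * ∑' w : Site d, tauPcE d (w - v) * tauPcE d (0 - w) := by rw [tsum_tau2_eq_percBubble]
    _ = ∑' w : Site d, percBubble d v * tauPcE d (w - v) * tauPcE d (0 - w) := by
        rw [← ENNReal.tsum_mul_left]; exact tsum_congr fun w => (mul_assoc _ _ _).symm

/-- `Σ_y τ(y)² ≤ 𝕂` (`d ≥ 1`). [folklore] -/
theorem tsum_tauPcE_sq_le (hd : 1 ≤ d) : ∑' y : Site d, tauPcE d y ^ 2 ≤ bigK d := by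
  rw [← percBubble_zero_eq]; exact percBubble_le_bigK hd 0

/-- `Σ_y τ̃(y)² ≤ 𝕂³` (`d ≥ 1`). [folklore] -/
theorem tsum_tauTildePcE_sq_le (hd : 1 ≤ d) : ∑' y : Site d, tauTildePcE d y ^ 2 ≤ bigK d ^ 3 := by
  calc ∑' y : Site d, tauTildePcE d y ^ 2 ≤ ∑' y : Site d, (2 * d * tauPcE d y) ^ 2 :=
        ENNReal.tsum_le_tsum fun y => pow_le_pow_left' (tauTildePcE_le y) 2
    _ = (2 * d) ^ 2 * ∑' y : Site d, tauPcE d y ^ 2 := by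
        rw [← ENNReal.tsum_mul_left]; exact tsum_congr fun y => by ring
    _ ≤ bigK d ^ 2 * bigK d := mul_le_mul' (pow_le_pow_left' two_mul_d_le_bigK 2) (tsum_tauPcE_sq_le hd)
    _ = bigK d ^ 3 := by ring

/-- `Σ_y bbT(y)² ≤ 𝕂³` (`d ≥ 1`; via `bbT ≤ 2d(τ⋆τ)` and `Σ(τ⋆τ)² = S(0) ≤ S̄`). [folklore] -/
theorem tsum_bbT_sq_le (hd : 1 ≤ d) : ∑' y : Site d, bbT d y ^ 2 ≤ bigK d ^ 3 := by
  calc ∑' y : Site d, bbT d y ^ 2 ≤ ∑' y : Site d, (2 * d * percBubble d y) ^ 2 :=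
        ENNReal.tsum_le_tsum fun y => pow_le_pow_left' (bbT_le_percBubble y) 2
    _ = (2 * d) ^ 2 * ∑' y : Site d, percBubble d y ^ 2 := by
        rw [← ENNReal.tsum_mul_left]; exact tsum_congr fun y => by ring
    _ ≤ bigK d ^ 2 * bigK d := by
        rw [tsum_percBubble_sq]
        exact mul_le_mul' (pow_le_pow_left' two_mul_d_le_bigK 2) ((percSq_le_percSqBar 0).trans (percSqBar_le_bigK hd))
    _ = bigK d ^ 3 := by ring

/-- `τ̃ ≤ 2d` pointwise. [folklore] -/
theorem tauTildePcE_le_two_d (v : Site d) : tauTildePcE d v ≤ 2 * d :=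
  (tauTildePcE_le v).trans (mul_le_of_le_one_right' (tauPcE_le_one v))

/-! ### One-line majorants of the erased kernels (entry form `X(p,P) ≤ c f(P_e - π p) ρ₁(P)`) -/

/-- `B₁` with its first line erased enters coordinate 2 with `τ̃`: `(P_{1,τ̃})(p,P) = τ̃(P.2 - p.2)`.
[cite: Hara2008, §3.5] -/
theorem le_entry_kProp_oneF_left (g : Site d → ℝ≥0∞) (p P : Site d × Site d) :
    kProp (oneF d) g p P ≤ 1 * g (crd false P - p.2) * (fun _ => (1 : ℝ≥0∞)) P := by
  simp [kProp]

/-- `B₁` with its second line erased enters coordinate 1 with `τ`. [cite: Hara2008, §3.5] -/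
theorem le_entry_kProp_oneF_right (f : Site d → ℝ≥0∞) (p P : Site d × Site d) :
    kProp f (oneF d) p P ≤ 1 * f (crd true P - p.1) * (fun _ => (1 : ℝ≥0∞)) P := by
  simp [kProp]

/-- The start triangle with its first line erased: `τ(P.2 - p.2) ρ(P)`. [cite: Hara2008, §3.5] -/
theorem le_entry_kRungR_kProp_oneF_left (g : Site d → ℝ≥0∞) (p P : Site d × Site d) :
    kRungR (kProp (oneF d) g) p P ≤ 1 * g (crd false P - p.2) * rho d P := by
  simp [kRungR, kProp]

/-- The start triangle with its second line erased: `τ(P.1 - p.1) ρ(P)`. [cite: Hara2008, §3.5] -/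
theorem le_entry_kRungR_kProp_oneF_right (f : Site d → ℝ≥0∞) (p P : Site d × Site d) :
    kRungR (kProp f (oneF d)) p P ≤ 1 * f (crd true P - p.1) * rho d P := by
  simp [kRungR, kProp]

/-- `B₂⁽¹⁾` with the crossed line out of coordinate 1 erased (its input rung moved to the previous
kernel): the other crossed line `τ(P.1 - p.2)` enters coordinate 1, then the output rung.
[cite: Hara2008, §3.5] -/
theorem le_entry_kRungR_kPropX_oneF_left (g : Site d → ℝ≥0∞) (p P : Site d × Site d) :
    kRungR (kPropX (oneF d) g) p P ≤ 1 * g (crd true P - p.2) * rho d P := by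
  simp [kRungR, kPropX]

/-- `B₂⁽¹⁾` with the crossed line out of coordinate 2 erased: `τ(P.2 - p.1)` enters coordinate 2.
[cite: Hara2008, §3.5] -/
theorem le_entry_kRungR_kPropX_oneF_right (f : Site d → ℝ≥0∞) (p P : Site d × Site d) :
    kRungR (kPropX f (oneF d)) p P ≤ 1 * f (crd false P - p.1) * rho d P := by
  simp [kRungR, kPropX]

/-! ### One-line majorants (exit form `Y(Q,q) ≤ ρ₂(Q) c g(Q_e - π q)`) -/

/-- `B₁` with its first line erased is left through coordinate 2 (`g` even). [cite: Hara2008, §3.5] -/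
theorem le_exit_kProp_oneF_left {g : Site d → ℝ≥0∞} (hg : ∀ v, g (-v) = g v) (Q q : Site d × Site d) :
    kProp (oneF d) g Q q ≤ (fun _ => (1 : ℝ≥0∞)) Q * (1 * g (crd false Q - q.2)) := by
  simp only [kProp, oneF_apply, one_mul, crd_false]
  rw [← neg_sub Q.2 q.2, hg]

/-- `B₁` with its second line erased is left through coordinate 1 (`f` even). [cite: Hara2008, §3.5] -/
theorem le_exit_kProp_oneF_right {f : Site d → ℝ≥0∞} (hf : ∀ v, f (-v) = f v) (Q q : Site d × Site d) :
    kProp f (oneF d) Q q ≤ (fun _ => (1 : ℝ≥0∞)) Q * (1 * f (crd true Q - q.1)) := by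
  simp only [kProp, oneF_apply, mul_one, one_mul, crd_true]
  rw [← neg_sub Q.1 q.1, hf]

/-- The end triangle with its first line erased: `ρ(Q) τ(q.2 - Q.2)`. [cite: Hara2008, §3.5] -/
theorem le_exit_kRungL_kProp_oneF_left {g : Site d → ℝ≥0∞} (hg : ∀ v, g (-v) = g v) (Q q : Site d × Site d) :
    kRungL (kProp (oneF d) g) Q q ≤ rho d Q * (1 * g (crd false Q - q.2)) := by
  simp only [kRungL, kProp, oneF_apply, one_mul, crd_false, rho_apply]
  rw [← neg_sub q.2, hg]

/-- The end triangle with its second line erased: `ρ(Q) τ(q.1 - Q.1)`. [cite: Hara2008, §3.5] -/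
theorem le_exit_kRungL_kProp_oneF_right {f : Site d → ℝ≥0∞} (hf : ∀ v, f (-v) = f v) (Q q : Site d × Site d) :
    kRungL (kProp f (oneF d)) Q q ≤ rho d Q * (1 * f (crd true Q - q.1)) := by
  simp only [kRungL, kProp, oneF_apply, mul_one, one_mul, crd_true, rho_apply]
  rw [← neg_sub q.1, hf]

/-- `B₂⁽¹⁾` with the crossed line out of coordinate 1 erased, as an exit (its output rung moved to
the next kernel): the input rung, then `τ(q.1 - Q.2)` out of coordinate 2. [cite: Hara2008, §3.5] -/
theorem le_exit_kRungL_kPropX_oneF_left {g : Site d → ℝ≥0∞} (hg : ∀ v, g (-v) = g v) (Q q : Site d × Site d) :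
    kRungL (kPropX (oneF d) g) Q q ≤ rho d Q * (1 * g (crd false Q - q.1)) := by
  simp only [kRungL, kPropX, oneF_apply, one_mul, crd_false, rho_apply]
  rw [← neg_sub q.1, hg]

/-- `B₂⁽¹⁾` with the crossed line out of coordinate 2 erased, as an exit: `τ(q.2 - Q.1)` out of
coordinate 1. [cite: Hara2008, §3.5] -/
theorem le_exit_kRungL_kPropX_oneF_right {f : Site d → ℝ≥0∞} (hf : ∀ v, f (-v) = f v) (Q q : Site d × Site d) :
    kRungL (kPropX f (oneF d)) Q q ≤ rho d Q * (1 * f (crd true Q - q.2)) := by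
  simp only [kRungL, kPropX, oneF_apply, mul_one, one_mul, crd_true, rho_apply]
  rw [← neg_sub q.2, hf]

/-! ### The merged star block `B₁ · kB2twoEr · B₁` -/

/-- The middle sum of the star block: `Σ_Q kB2twoEr(m, Q) B₁(Q, P) = τ(P.1 - m.2) Σ_a τ(a - m.1) τ(m.2 - a) bbT(P.2 - a)`.
[cite: HeydenreichVanDerHofstad2017, (7.4.4)] -/
theorem tsum_kB2twoEr_mul_kB1 (m P : Site d × Site d) :
    ∑' Q, kB2twoEr d m Q * kB1 d Q P = tauPcE d (P.1 - m.2) *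
      ∑' a : Site d, tauPcE d (a - m.1) * tauPcE d (m.2 - a) * bbT d (P.2 - a) := by
  rw [ENNReal.tsum_prod', tsum_eq_single m.2]
  · simp only [kB2twoEr, if_true, kB1_eq_kProp, kProp]
    calc ∑' w : Site d, (∑' a : Site d, tauPcE d (a - m.1) * tauPcE d (m.2 - a) * tauPcE d (w - a)) *
          (tauPcE d (P.1 - m.2) * tauTildePcE d (P.2 - w))
        = ∑' w : Site d, ∑' a : Site d, tauPcE d (P.1 - m.2) * (tauPcE d (a - m.1) * tauPcE d (m.2 - a) *
            (tauPcE d (w - a) * tauTildePcE d (P.2 - w))) := by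
          refine tsum_congr fun w => ?_
          rw [← ENNReal.tsum_mul_right]
          exact tsum_congr fun a => by ring
      _ = ∑' a : Site d, ∑' w : Site d, tauPcE d (P.1 - m.2) * (tauPcE d (a - m.1) * tauPcE d (m.2 - a) *
            (tauPcE d (w - a) * tauTildePcE d (P.2 - w))) := ENNReal.tsum_comm
      _ = _ := by
          rw [← ENNReal.tsum_mul_left]
          refine tsum_congr fun a => ?_
          rw [ENNReal.tsum_mul_left, ENNReal.tsum_mul_left, tsum_tau_tauTilde_eq_bbT]
  · intro w hw
    simp [kB2twoEr, Ne.symm hw]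

/-- `Σ_z τ(z - a) (τ⋆τ)(b - z) = Δ(b - a)`. [cite: HeydenreichVanDerHofstad2017, (7.2.1)] -/
theorem tsum_tau_mul_percBubble_eq_percTri (a b : Site d) :
    ∑' z : Site d, tauPcE d (z - a) * percBubble d (b - z) = percTri d (b - a) := by
  rw [percTri_eq_tsum_tau_mul_percBubble, tsum_shift _ a]
  refine tsum_congr fun z => ?_
  rw [add_sub_cancel_right, show b - (z + a) = b - a - z by abel]

/-- **The merged star block is one line**: `(B₁ · kB2twoEr · B₁)(p, P) ≤ Δ̃ Δ̄ bbT(P.1 - p.2)` — the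
star leg into the loose end `P.2` costs `bbT ≤ Δ̃`, the star with the `B₁`-line before it is a
triangle `≤ Δ̄`, and what remains is the pivotal line followed by `τ`, i.e. `bbT(P.1 - p.2)`.
[cite: Hara2008, §3.5 (Case 2, Fig. 5 (d-3): "triangles, squares")] -/
theorem pkMul_kB1_kB2twoEr_kB1_le (p P : Site d × Site d) :
    pkMul (kB1 d) (pkMul (kB2twoEr d) (kB1 d)) p P ≤
      percTriTildeBar d * percTriBar d * bbT d (P.1 - p.2) := by
  calc pkMul (kB1 d) (pkMul (kB2twoEr d) (kB1 d)) p P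
      = ∑' m, kB1 d p m * (tauPcE d (P.1 - m.2) *
          ∑' a : Site d, tauPcE d (a - m.1) * tauPcE d (m.2 - a) * bbT d (P.2 - a)) := by
        refine tsum_congr fun m => ?_
        rw [pkMul, tsum_kB2twoEr_mul_kB1]
    _ ≤ ∑' m, kB1 d p m * (tauPcE d (P.1 - m.2) *
          ∑' a : Site d, tauPcE d (a - m.1) * tauPcE d (m.2 - a) * percTriTildeBar d) :=
        ENNReal.tsum_le_tsum fun m => mul_le_mul' le_rfl (mul_le_mul' le_rfl
          (ENNReal.tsum_le_tsum fun a => mul_le_mul' le_rfl (bbT_le_percTriTildeBar _)))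
    _ = percTriTildeBar d * ∑' m : Site d × Site d, tauTildePcE d (m.2 - p.2) * tauPcE d (P.1 - m.2) *
          (tauPcE d (m.1 - p.1) * percBubble d (m.2 - m.1)) := by
        rw [← ENNReal.tsum_mul_left]
        refine tsum_congr fun m => ?_
        rw [ENNReal.tsum_mul_right, tsum_tau2_eq_percBubble, kB1_eq_kProp, kProp]
        ring
    _ = percTriTildeBar d * ∑' t : Site d, tauTildePcE d (t - p.2) * tauPcE d (P.1 - t) *
          ∑' z : Site d, tauPcE d (z - p.1) * percBubble d (t - z) := by
        congr 1
        rw [ENNReal.tsum_prod', ENNReal.tsum_comm]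
        refine tsum_congr fun t => ?_
        dsimp only
        exact ENNReal.tsum_mul_left
    _ ≤ percTriTildeBar d * ∑' t : Site d, tauTildePcE d (t - p.2) * tauPcE d (P.1 - t) * percTriBar d := by
        refine mul_le_mul' le_rfl (ENNReal.tsum_le_tsum fun t => mul_le_mul' le_rfl ?_)
        rw [tsum_tau_mul_percBubble_eq_percTri]
        exact le_iSup (percTri d) _
    _ = percTriTildeBar d * percTriBar d * bbT d (P.1 - p.2) := by
        rw [ENNReal.tsum_mul_right, tsum_tauTilde_tau_eq_bbT]; ring

/-- The merged star block as an ENTRY: `≤ (Δ̃Δ̄) bbT(P.1 - p.2) · 1`. [cite: Hara2008, §3.5 (Case 2)] -/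
theorem le_entry_star (p P : Site d × Site d) :
    pkMul (kB1 d) (pkMul (kB2twoEr d) (kB1 d)) p P ≤
      (percTriTildeBar d * percTriBar d) * bbT d (crd true P - p.2) * (fun _ => (1 : ℝ≥0∞)) P := by
  simpa using pkMul_kB1_kB2twoEr_kB1_le p P

/-- The merged star block as an EXIT: `≤ 1 · (Δ̃Δ̄) bbT(Q.2 - q.1)`. [cite: Hara2008, §3.5 (Case 2)] -/
theorem le_exit_star (Q q : Site d × Site d) :
    pkMul (kB1 d) (pkMul (kB2twoEr d) (kB1 d)) Q q ≤
      (fun _ => (1 : ℝ≥0∞)) Q * ((percTriTildeBar d * percTriBar d) * bbT d (crd false Q - q.1)) := by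
  have h := pkMul_kB1_kB2twoEr_kB1_le Q q
  rw [← neg_sub Q.2 q.1, bbT_neg] at h
  simpa using h

/-! ### The entry/exit constants are at most `𝕂⁷` -/

/-- `1² Σ τ² ≤ 𝕂⁷`. [folklore] -/
theorem entryConst_tau_le (hd : 1 ≤ d) : (1 : ℝ≥0∞) ^ 2 * ∑' y : Site d, tauPcE d y ^ 2 ≤ bigK d ^ 7 := by
  rw [one_pow, one_mul]; exact le_bigK_pow_of_le_bigK hd (tsum_tauPcE_sq_le hd) (by norm_num)

/-- `1² Σ τ̃² ≤ 𝕂⁷`. [folklore] -/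
theorem entryConst_tauTilde_le (hd : 1 ≤ d) : (1 : ℝ≥0∞) ^ 2 * ∑' y : Site d, tauTildePcE d y ^ 2 ≤ bigK d ^ 7 := by
  rw [one_pow, one_mul]; exact le_bigK_pow_of_le hd (tsum_tauTildePcE_sq_le hd) (by norm_num)

/-- `(Δ̃Δ̄)² Σ bbT² ≤ 𝕂⁷`. [folklore] -/
theorem entryConst_star_le (hd : 1 ≤ d) :
    (percTriTildeBar d * percTriBar d) ^ 2 * ∑' y : Site d, bbT d y ^ 2 ≤ bigK d ^ 7 := by
  calc (percTriTildeBar d * percTriBar d) ^ 2 * ∑' y : Site d, bbT d y ^ 2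
      ≤ (bigK d * bigK d) ^ 2 * bigK d ^ 3 :=
        mul_le_mul' (pow_le_pow_left' (mul_le_mul' percTriTildeBar_le_bigK (percTriBar_le_bigK hd)) 2) (tsum_bbT_sq_le hd)
    _ = bigK d ^ 7 := by ring

end Erased

end Literature.Barriers.CriticalPhenomena
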